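import Summits.AtomisticToContinuum.HydrodynamicLimit.Theses.AntiMazurCoboundaries
import Literature.MathematicalPhysics.KineticTheory.HardSphereEulerProofs
import Literature.MathematicalPhysics.KineticTheory.HardBallErgodicity
import Summits.AtomisticToContinuum.HydrodynamicLimit.Theorems.AntiMazurCoboundariesCorrectorPressureDecaySliceGlue

/-!
# Stub `stub_airOfCrux` of line `almost-invariant-duality` — crux `AntiMazurCoboundaries.CorrectorPressureDecay`
(stmt-AtomisticToContinuum-14135)

Helper file (`--supports stmt-AtomisticToContinuum-14135`) proving the registered stub `stub_airOfCrux` of the lead's skeleton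
`Cruxes/CorrectorPressureDecay/Lines/almost_invariant_duality.lean` (line lead prover-line-stmt-AtomisticToContinuum-14135-1): WEAK DUALITY,
the crux implies the line's hardest stub `stub_almostInvariantRigidity`. The crux's own witness `(lag, W)` (one per `N, Φ`) serves every
state `ρ` at once: the cost clause is the crux's, and the pay-off `2∫(F − D_W)ρ dG − ∫ρ log ρ dG` is at most `log∫e^{2(F−D_W)}dG ≤ δ(N+1)`
by the Gibbs (Donsker–Varadhan) inequality `integral_mul_sub_entropy_le_log_integral_exp` (landed with the slice glue) applied to the
bounded measurable potential `2(F − D_W)`, the crux's `∫⁻` defect clause being converted to a Bochner one. Adapted from the parallel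
lead c1's workfile `Cruxes/CorrectorPressureDecay/Lines/almost_invariant_duality_costume.lean` (rc0). Together with the skeleton's
sorry-free composition (stubs 1–3 landed) this certifies `stub_almostInvariantRigidity ⇔ CorrectorPressureDecay`.
-/

noncomputable section

open MeasureTheory ProbabilityTheory Set Filter Topology
open scoped ENNReal

namespace Summit.AtomisticToContinuum.HydrodynamicLimit.Theorems.AlmostInvariantDuality

open Literature.MathematicalPhysics.KineticTheory (T3 V3 hsDiameter localGibbsLaw)
open Literature.Analysis.FluidPDE (HardSphereFlow Config configMomentum configEnergy)
open Summit.AtomisticToContinuum.HydrodynamicLimit.Theses.AntiMazurCoboundaries (CorrectorPressureDecay)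


/-- Measurability of the crux's one-body observable `F z = Σᵢ φ(xᵢ) g(ṽᵢ)` (continuity; `Config` over the torus is Borel). -/
private theorem measurable_flux {θ : ℝ} {u₀ : V3} {φ : T3 → ℝ} {g : V3 → ℝ} (hφ : Continuous φ)
    (hg : Continuous g) (N : ℕ) :
    Measurable (fun z : Config (N + 1) (Fin 3) T3 => ∑ i, φ (z i).1 * g ((Real.sqrt θ)⁻¹ • ((z i).2 - u₀))) := by
  refine Continuous.measurable ?_
  fun_prop

/-- `|F z| ≤ (N+1)κ`. -/
private theorem abs_flux_le {θ κ : ℝ} {u₀ : V3} {φ : T3 → ℝ} {g : V3 → ℝ} (hφ1 : ∀ x, |φ x| ≤ 1)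
    (hgκ : ∀ v, |g v| ≤ κ) (N : ℕ) (z : Config (N + 1) (Fin 3) T3) :
    |∑ i, φ (z i).1 * g ((Real.sqrt θ)⁻¹ • ((z i).2 - u₀))| ≤ (N + 1) * κ := by
  calc |∑ i, φ (z i).1 * g ((Real.sqrt θ)⁻¹ • ((z i).2 - u₀))|
      ≤ ∑ i, |φ (z i).1 * g ((Real.sqrt θ)⁻¹ • ((z i).2 - u₀))| := Finset.abs_sum_le_sum_abs _ _
    _ ≤ ∑ _i : Fin (N + 1), κ := by
        refine Finset.sum_le_sum fun i _ => ?_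
        rw [abs_mul]
        calc |φ (z i).1| * |g ((Real.sqrt θ)⁻¹ • ((z i).2 - u₀))|
            ≤ 1 * κ := mul_le_mul (hφ1 _) (hgκ _) (abs_nonneg _) zero_le_one
          _ = κ := one_mul κ
    _ = (N + 1) * κ := by simp

/-- For a bounded measurable function the exponential is integrable against a finite measure. -/
private theorem integrable_exp_of_abs_le' {X : Type*} [MeasurableSpace X] {μ : Measure X} [IsFiniteMeasure μ]
    {V : X → ℝ} (hVm : Measurable V) {C : ℝ} (hVC : ∀ x, |V x| ≤ C) :
    Integrable (fun x => Real.exp (V x)) μ := by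
  refine Integrable.of_bound hVm.exp.aestronglyMeasurable (Real.exp C) (ae_of_all _ fun x => ?_)
  rw [Real.norm_eq_abs, abs_of_pos (Real.exp_pos _)]
  exact Real.exp_le_exp.2 ((le_abs_self _).trans (hVC x))

/-- STUB 4′ (size M; TRUE — WEAK DUALITY, the logical position of the wall): the crux implies stub 4
(`CorrectorPressureDecay → AlmostInvariantRigidity`). Given the crux's `(lag, W)` for `(N, Φ)` put `M := max C 0`
(`|W| ≤ C`); for every density `ρ` (and every profile `f`, unused) the same `W` is a witness: the cost clause is the
crux's, and the pay-off is bounded by the entropy inequality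
`2∫(F − D_W)ρ dG − ∫ρ log ρ dG ≤ log∫e^{2(F−D_W)}dG ≤ δ(N+1)`
(`integral_mul_sub_entropy_le_log_integral_exp` of the landed SliceGlue file, with `Y = 2(F − D_W)` bounded measurable,
and the crux's defect clause converted from `∫⁻` to `∫` by `ofReal_integral_eq_lintegral_ofReal`). Together with the
skeleton's composition (stubs 1–3 TRUE and landed/derived) this certifies STUB 4 ⇔ CRUX. Not used by
`CorrectorPressureDecay_of`. -/
theorem stub_airOfCrux :
    CorrectorPressureDecay →
    (∀ (σ a θ : ℝ) (u₀ : V3), 0 < σ → 0 < a → 0 < θ → ∀ (N : ℕ)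
      (Φ : HardSphereFlow (Literature.Analysis.FluidPDE.Torus.geometry (Fin 3)) (hsDiameter σ N) (N + 1)) (t : ℝ),
      MeasurePreserving (Φ.flow t) (localGibbsLaw σ (fun _ => a) (fun _ => u₀) (fun _ => θ) N Φ)
        (localGibbsLaw σ (fun _ => a) (fun _ => u₀) (fun _ => θ) N Φ)) →
    ∀ (a θ : ℝ) (u₀ : V3), 0 < a → 0 < θ → ∃ σ₀ : ℝ, 0 < σ₀ ∧ ∀ σ : ℝ, 0 < σ → σ < σ₀ →
      ∃ κ : ℝ, 0 < κ ∧ ∀ (φ : T3 → ℝ) (g : V3 → ℝ), Continuous φ → Continuous g →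
        (∀ x, |φ x| ≤ 1) → (∀ v, |g v| ≤ κ) →
        (∀ (c₀ c₂ : ℝ) (b : V3),
          ∫ v, g v * (c₀ + inner ℝ b v + c₂ * ‖v‖ ^ 2) ∂(stdGaussian V3) = 0) →
        ∀ δ : ℝ, 0 < δ → ∃ τ₀ : ℝ, 0 < τ₀ ∧ ∃ N₀ : ℕ, ∀ N : ℕ, N₀ ≤ N →
          ∀ Φ : HardSphereFlow (Literature.Analysis.FluidPDE.Torus.geometry (Fin 3)) (hsDiameter σ N) (N + 1),
          ∃ lag : ℝ, 0 < lag ∧ ∃ M : ℝ, 0 ≤ M ∧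
            ∀ ρ : Config (N + 1) (Fin 3) T3 → ℝ, Measurable ρ → (∀ z, 0 ≤ ρ z) → (∃ C : ℝ, ∀ z, ρ z ≤ C) →
              ∫ z, ρ z ∂(localGibbsLaw σ (fun _ => a) (fun _ => u₀) (fun _ => θ) N Φ) = 1 →
              ∀ f : V3 → ℝ → ℝ, Measurable (fun p : V3 × ℝ => f p.1 p.2) → (∀ p e, 0 ≤ f p e) →
                (∃ C : ℝ, ∀ p e, f p e ≤ C) →
                (∀ B : V3 → ℝ → ℝ, Measurable (fun p : V3 × ℝ => B p.1 p.2) →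
                  (∃ C : ℝ, ∀ p e, |B p e| ≤ C) →
                  ∫ z, B (configMomentum z) (configEnergy z) * ρ z ∂(localGibbsLaw σ (fun _ => a) (fun _ => u₀) (fun _ => θ) N Φ) =
                    ∫ z, B (configMomentum z) (configEnergy z) *
                      f (configMomentum z) (configEnergy z) ∂(localGibbsLaw σ (fun _ => a) (fun _ => u₀) (fun _ => θ) N Φ)) →
                2 * ∫ z, (∑ i, φ (z i).1 * g ((Real.sqrt θ)⁻¹ • ((z i).2 - u₀))) *
                      f (configMomentum z) (configEnergy z) ∂(localGibbsLaw σ (fun _ => a) (fun _ => u₀) (fun _ => θ) N Φ) -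
                    ∫ z, f (configMomentum z) (configEnergy z) *
                      Real.log (f (configMomentum z) (configEnergy z)) ∂(localGibbsLaw σ (fun _ => a) (fun _ => u₀) (fun _ => θ) N Φ)
                  ≤ δ / 2 * (N + 1) →
                ∃ W : Config (N + 1) (Fin 3) T3 → ℝ, Measurable W ∧ (∀ z, |W z| ≤ M) ∧
                  ∫⁻ z, ENNReal.ofReal (Real.exp (4 * (τ₀ * ((N + 1 : ℕ) : ℝ) ^ (-(1 / 3 : ℝ)))⁻¹ * |W z|))
                      ∂(localGibbsLaw σ (fun _ => a) (fun _ => u₀) (fun _ => θ) N Φ) ≤ ENNReal.ofReal (Real.exp (δ * (N + 1))) ∧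
                  2 * ∫ z, ((∑ i, φ (z i).1 * g ((Real.sqrt θ)⁻¹ • ((z i).2 - u₀))) - lag⁻¹ * (W (Φ.flow lag z) - W z)) * ρ z
                      ∂(localGibbsLaw σ (fun _ => a) (fun _ => u₀) (fun _ => θ) N Φ) -
                    ∫ z, ρ z * Real.log (ρ z) ∂(localGibbsLaw σ (fun _ => a) (fun _ => u₀) (fun _ => θ) N Φ) ≤ δ * (N + 1) := by
  intro hX _ a θ u₀ ha hθ
  obtain ⟨σ₀, hσ₀, Hσ⟩ := hX a θ u₀ ha hθ
  refine ⟨σ₀, hσ₀, fun σ hσ hσlt => ?_⟩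
  obtain ⟨hprob, κ, hκ, Hφ⟩ := Hσ σ hσ hσlt
  refine ⟨κ, hκ, fun φ g hφ hg hφ1 hgκ horth δ hδ => ?_⟩
  obtain ⟨τ₀, hτ₀, N₀, HN⟩ := Hφ φ g hφ hg hφ1 hgκ horth δ hδ
  refine ⟨τ₀, hτ₀, N₀, fun N hN Φ => ?_⟩
  obtain ⟨lag, hlag, W, hWm, ⟨CW, hCW⟩, hdef, hcost⟩ := HN N hN Φ
  haveI := hprob N Φ
  refine ⟨lag, hlag, max CW 0, le_max_right _ _, fun ρ hρm hρ0 hρC hρ1 _ _ _ _ _ _ => ?_⟩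
  obtain ⟨Cρ, hCρ⟩ := hρC
  refine ⟨W, hWm, fun z => (hCW z).trans (le_max_left _ _), hcost, ?_⟩
  -- the bounded measurable potential `Y = 2(F − D_W)`
  obtain ⟨Y, hYdef⟩ : ∃ Y : Config (N + 1) (Fin 3) T3 → ℝ, Y = fun z =>
      2 * ((∑ i, φ (z i).1 * g ((Real.sqrt θ)⁻¹ • ((z i).2 - u₀))) - lag⁻¹ * (W (Φ.flow lag z) - W z)) := ⟨_, rfl⟩
  have hYm : Measurable Y := by
    rw [hYdef]
    exact measurable_const.mul ((measurable_flux hφ hg N).sub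
      (measurable_const.mul ((hWm.comp (Φ.measurable_flow lag)).sub hWm)))
  have hYb : ∀ z, |Y z| ≤ 2 * ((N + 1) * κ + lag⁻¹ * (CW + CW)) := by
    intro z
    have h1 : |lag⁻¹ * (W (Φ.flow lag z) - W z)| ≤ lag⁻¹ * (CW + CW) := by
      rw [abs_mul, abs_of_pos (inv_pos.2 hlag)]
      exact mul_le_mul_of_nonneg_left ((abs_sub _ _).trans (add_le_add (hCW _) (hCW _))) (inv_pos.2 hlag).le
    have h2 : |(∑ i, φ (z i).1 * g ((Real.sqrt θ)⁻¹ • ((z i).2 - u₀))) - lag⁻¹ * (W (Φ.flow lag z) - W z)| ≤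
        (N + 1) * κ + lag⁻¹ * (CW + CW) :=
      (abs_sub _ _).trans (add_le_add (abs_flux_le hφ1 hgκ N z) h1)
    rw [hYdef]
    dsimp only
    rw [abs_mul, abs_two]
    exact mul_le_mul_of_nonneg_left h2 zero_le_two
  -- from the `lintegral` defect bound of the crux to the Bochner one, then to its logarithm
  have hexpint : Integrable (fun z => Real.exp (Y z)) (localGibbsLaw σ (fun _ => a) (fun _ => u₀) (fun _ => θ) N Φ) :=
    integrable_exp_of_abs_le' hYm hYb
  have hdefR : ∫ z, Real.exp (Y z) ∂(localGibbsLaw σ (fun _ => a) (fun _ => u₀) (fun _ => θ) N Φ) ≤ Real.exp (δ * (N + 1)) := by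
    have h1 : ENNReal.ofReal (∫ z, Real.exp (Y z) ∂(localGibbsLaw σ (fun _ => a) (fun _ => u₀) (fun _ => θ) N Φ)) ≤
        ENNReal.ofReal (Real.exp (δ * (N + 1))) := by
      rw [ofReal_integral_eq_lintegral_ofReal hexpint (ae_of_all _ fun z => (Real.exp_pos _).le), hYdef]
      exact hdef
    exact (ENNReal.ofReal_le_ofReal_iff (Real.exp_pos _).le).1 h1
  have hlog : Real.log (∫ z, Real.exp (Y z) ∂(localGibbsLaw σ (fun _ => a) (fun _ => u₀) (fun _ => θ) N Φ)) ≤ δ * (N + 1) := by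
    have hpos : 0 < ∫ z, Real.exp (Y z) ∂(localGibbsLaw σ (fun _ => a) (fun _ => u₀) (fun _ => θ) N Φ) :=
      integral_exp_pos hexpint
    rw [← Real.log_exp (δ * (N + 1))]
    exact Real.log_le_log hpos hdefR
  have hmain := integral_mul_sub_entropy_le_log_integral_exp (μ := localGibbsLaw σ (fun _ => a) (fun _ => u₀) (fun _ => θ) N Φ)
    hρm hYm hρ0 hCρ hYb hρ1
  -- `∫ Y ρ = 2 ∫ (F − D_W) ρ`
  have hYρ : ∫ z, Y z * ρ z ∂(localGibbsLaw σ (fun _ => a) (fun _ => u₀) (fun _ => θ) N Φ) =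
      2 * ∫ z, ((∑ i, φ (z i).1 * g ((Real.sqrt θ)⁻¹ • ((z i).2 - u₀))) - lag⁻¹ * (W (Φ.flow lag z) - W z)) * ρ z
        ∂(localGibbsLaw σ (fun _ => a) (fun _ => u₀) (fun _ => θ) N Φ) := by
    rw [← integral_const_mul]
    refine integral_congr_ae (ae_of_all _ fun z => ?_)
    rw [hYdef]
    dsimp only
    ring
  linarith [hmain, hYρ, hlog]

end Summit.AtomisticToContinuum.HydrodynamicLimit.Theorems.AlmostInvariantDuality

end
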